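import Summits.MatrixMultiplication.MatrixMultiplication.Theorems.AbelianSTPPCensusFP2Defs

/-!
# Rule FPq-cyc of the abelian STPP census: Pollard fibred over a prime-order subgroup with CYCLIC quotient of any order `q` (`FPQ.AdmC`)

Cell mm-stpp (rung F-M1), theory lane «past the walls» (seat mm-stpp-theory, gen 18).  Definitions only (no checker, no claim).

At an order `M = q·p` with `p` prime, a finite abelian group `H` of order `M` has a subgroup `P` of order `p`; when `q` is squarefree the
quotient `H ⧸ P` is cyclic of order `q` (every abelian group of squarefree order is cyclic), i.e. there is an additive surjection
`lab : H → ℤ/q` with kernel `P`.  With `X = ⋃ (B_j − A_j)`, `Y = ⋃ (C_k − B_k)`, `Z′ = ⋃ (C_i − A_i)` (tree `diffUnion`; `r_{X,Y} = b_i` on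
`C_i − A_i`) and their class counts `x, y, z : ℤ/q → ℕ`, the target class `c ∈ ℤ/q` (`W = z c` points of `Z′`) is fed by the `q` class pairs
`(X_g, Y_{c−g})`, all of whose sums have class `c`; Pollard's theorem holds inside every coset pair (`P ≅ ℤ/p`).  `FPQ.TargetOKC` collects, for one
target class, the consequences proved for an arbitrary family of coset representatives in `AbelianSTPPCensusFPQCore` (p710111):
* (F1) for all levels `τ_g ≤ min(x_g, y_{c−g})`: `Σ_g τ_g·min(p, x_g + y_{c−g} − τ_g) ≤ W·min(T, cap) + T·(p − W)`, `T = Σ_g τ_g` (`FPQ.sum_pairFloor_le`);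
* (F2) `vmin·W ≤ Σ_g x_g·y_{c−g}` (`FPQ.vmin_mul_card_le`);  (F3) `W ≥ 1 → vmin ≤ Σ_g min(x_g, y_{c−g})` (`FPQ.vmin_le_sum_min`);
* (PH) `W ≥ 1 → Σ_g (x_g + y_{c−g} − p)₊ ≤ cap` (`FPQ.sum_excess_le`);  and `W ≤ p`.
`FPQ.FormOKC` = totals + class sizes `≤ p` + every target class; `FPQ.AdmC q M a b c` = IF `M = q·p` with `p` prime THEN for all letter lower
bounds some `(x, y, z)` passes form B (`X, Y → Z′`, values `b`), form A (`−Z′, X → −Y`, values `a`, the rotated family `(C, A, B)`) and form C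
(`Y, −Z′ → −X`, values `c`, the rotated family `(B, C, A)`) — the class counts of `−S` being those of `S` at the negated classes.  This is the
`q`-class generalisation of `FP2.FP2Adm` (`q = 2`) and `FP4.FP4Adm` (`q = 4`, where also the non-cyclic quotient is needed); soundness for every
squarefree `q` is `AbelianSTPPCensusFPQCycSound`.  A certificate against `AdmC` is a refutation of the EXISTENCE of class-count functions on
`ℤ/q` — for `q ≥ 25` necessarily position-aware (HOME/mm-stpp-theory/FPQ-NOTE.md §§4, 7); none is in this file.
WHAT THIS IS NOT: no claim, no checker, no census number, no `ω` statement; vacuous unless `M = q·p` with `p` prime.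
-/

set_option linter.dupNamespace false -- `MatrixMultiplication.MatrixMultiplication` (summit = problem, D-0017)
set_option autoImplicit false

namespace Summit.MatrixMultiplication.MatrixMultiplication.Theorems

open Finset

namespace FPQ

variable (q : ℕ) [NeZero q]

/-- One TARGET CLASS `c` of a letter form with classes indexed by `ℤ/q`: summand class counts `u, v` (pairs `(u_g, v_{c−g})`), `W` target
points in class `c` with `r`-values in `[vmin, cap]`, cosets of size `p`: `W ≤ p`; (F1) the `q` Pollard floors (tree `FP2.pairFloor`) at any
admissible levels jointly below the ceiling `W·min(T, cap) + T·(p − W)`; (F2) mass; (F3) pointwise; (PH) pigeonhole (shape-level predicate,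
no claim). [original] -/
def TargetOKC (p cap vmin : ℕ) (u v : ZMod q → ℕ) (c : ZMod q) (W : ℕ) : Prop :=
  W ≤ p ∧
  (∀ τ : ZMod q → ℕ, (∀ g, τ g ≤ u g ∧ τ g ≤ v (c - g)) →
    ∑ g, FP2.pairFloor p (u g) (v (c - g)) (τ g) ≤ W * min (∑ g, τ g) cap + (∑ g, τ g) * (p - W)) ∧
  vmin * W ≤ ∑ g, u g * v (c - g) ∧
  (1 ≤ W → vmin ≤ ∑ g, min (u g) (v (c - g))) ∧
  (1 ≤ W → ∑ g, (u g + v (c - g) - p) ≤ cap)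

/-- One LETTER FORM `U + V → W′` with classes indexed by `ℤ/q`: totals `SU, SV, SW`, summand classes of size `≤ p`, every target class
`TargetOKC` (shape-level predicate, no claim). [original] -/
def FormOKC (p cap vmin SU SV SW : ℕ) (u v w : ZMod q → ℕ) : Prop :=
  ∑ g, u g = SU ∧ ∑ g, v g = SV ∧ ∑ g, w g = SW ∧ (∀ g, u g ≤ p) ∧ (∀ g, v g ≤ p) ∧
  ∀ c, TargetOKC q p cap vmin u v c (w c)

variable {N : ℕ}

/-- **Rule FPq-cyc (Pollard fibred over a prime-order subgroup with cyclic quotient `ℤ/q`), shape form.**  At an order `M = q·p` with `p`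
prime, for every choice of lower bounds `va ≤ a_i`, `vb ≤ b_i`, `vc ≤ c_i`, there are class counts `x, y, z : ℤ/q → ℕ` of `X = ⋃(B − A)`,
`Y = ⋃(C − B)`, `Z′ = ⋃(C − A)` passing form B (`X, Y → Z′`, values `b`), form A (`−Z′, X → −Y`, values `a`; rotated family `(C, A, B)`; the counts of
`−S` are those of `S` at the negated classes) and form C (`Y, −Z′ → −X`, values `c`; rotated family `(B, C, A)`).  Vacuous unless `M = q·p` with `p`
prime.  The shape data of every `IsSTPP` family with non-empty sets in a finite abelian group of order `M` satisfies it whenever `q` is squarefree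
(`FPQ.admC_of_isSTPP`, file `AbelianSTPPCensusFPQCycSound`).  No claim by itself. [original] -/
def AdmC (M : ℕ) (a b c : Fin N → ℕ) : Prop :=
  ∀ p : ℕ, M = q * p → p.Prime →
    ∀ va vb vc : ℕ, (∀ i, va ≤ a i) → (∀ i, vb ≤ b i) → (∀ i, vc ≤ c i) →
      ∃ x y z : ZMod q → ℕ,
        FormOKC q p (univ.sup b) vb (pAB a b c) (pBC a b c) (pCA a b c) x y z ∧
        FormOKC q p (univ.sup a) va (pCA a b c) (pAB a b c) (pBC a b c) (fun g => z (-g)) x (fun g => y (-g)) ∧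
        FormOKC q p (univ.sup c) vc (pBC a b c) (pCA a b c) (pAB a b c) y (fun g => z (-g)) (fun g => x (-g))

end FPQ

end Summit.MatrixMultiplication.MatrixMultiplication.Theorems
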